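import Summits.AtomisticToContinuum.HydrodynamicLimit.Theorems.OneSphereInfluenceAssembly
import Summits.AtomisticToContinuum.HydrodynamicLimit.Theorems.PreShockHomotopyProved
import Summits.AtomisticToContinuum.HydrodynamicLimit.Theses.ResponseRigidity
import Summits.AtomisticToContinuum.HydrodynamicLimit.Theorems.OneSphereInfluenceAscoliMeanDoor
import HarnessLib

/-!
# Score-response dominance: `ScoreLinearResponse` alone implies the conjunct `HydrodynamicLimit`

Node «ScoreResponseDominance» of the root decomposition cell `decomp-a2c` (lens-1, gen 51), for the
route `OneSphereInfluence` (`closes (h₂ : ScoreLinearResponse) (h₃ : ResamplingInfluence)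
(h₄ : HardCorePoincare) (hP : PreShockHomotopy) (hR : MeanVarianceReduction) : HydrodynamicLimit`).

STRUCTURAL VERDICT, kernel-checked here: the rank-2 crux `ScoreLinearResponse` (X_A,
stmt-AtomisticToContinuum-13617) implies the sub-problem conjunct `_root_.HydrodynamicLimit` ON ITS OWN —
`ResamplingInfluence` (X_B, stmt-13618), `HardCorePoincare` and `MeanVarianceReduction` are not
load-bearing for the conjunct:

* `meanHydroLimitInBand_of_scoreLinearResponse : ScoreLinearResponse → MeanHydroLimitInBand` — the MEAN
  half of the assembly `oneSphereInfluence_assembly` (pre-shock homotopy `preShockHomotopy_holds` through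
  `t`; finite-`N` score identity + mean value inequality in `κ`, anchored at the flow-invariant constant
  state by `HomogeneousInvariance_holds` and the `κ = 0` law of large numbers; landed
  `tendsto_integral_of_uniform_covariance`) — with the variance half (Poincaré × resampling influence,
  Chebyshev) DROPPED; the packing guard of `MeanHydroLimitInBand` is not used (`η := 1`);
* hence `ScoreLinearResponse → _root_.HydrodynamicLimit` by the landed equivalence
  `RestartPrinciple.hydrodynamicLimit_iff_meanHydroLimitInBand` (mean closure `MeanClosure`, stmt-11929,
  PROVED: `RestartPrinciple.AgeDuhamelForgetting.meanClosure_holds`) — that one-line composition is in the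
  companion file `ScoreResponseDominanceFull.lean`, whose import
  `…Theorems.RelayRaceLocalityRestartPrincipleOfMeanHL` was farm-stale at the time of writing (this file's
  closure — Assembly, PreShockHomotopyProved, AscoliMeanDoor, `Theses.ResponseRigidity` — checks now);
* `meanHydroLimitInBand_of_meanConvergenceOnHull : AscoliMeanDoor.MeanConvergenceOnHull → MeanHydroLimitInBand`
  — the piece `[M]` of node «AscoliMeanDoor» (landed
  `Theorems/OneSphereInfluenceAscoliMeanDoor.lean`) is itself ≥ the conjunct (its COSTUME tag made exact).

Consequences for the cell (see EXCERPT-g51): `OneSphereInfluence` is a STRENGTHENING route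
(X_A = mean hydrodynamic limit on hull paths ⊕ `κ`-equicontinuity of the score covariances ⊕ no packing
guard), not a decomposition of the conjunct; the honest residual of the conjunct is
`ResponseRigidity.MeanHydroLimitInBand` (stmt-11927) via the landed
`RestartPrinciple.hydrodynamicLimit_iff_meanHydroLimitInBand`.

References: H. Spohn, *Large Scale Dynamics of Interacting Particles* (1991), Part I Ch. 3, Part II §7.1.
-/

noncomputable section

open MeasureTheory ProbabilityTheory Filter Set Topology Real
open scoped InnerProductSpace ENNReal

namespace Summit.AtomisticToContinuum.HydrodynamicLimit.Theorems.ScoreResponseDominance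

open Literature.Analysis.FluidPDE Literature.MathematicalPhysics.KineticTheory
open Summit.AtomisticToContinuum.HydrodynamicLimit.Theses
open Summit.AtomisticToContinuum.HydrodynamicLimit.Theses.OneSphereInfluence
open Summit.AtomisticToContinuum.HydrodynamicLimit.Theorems.OneSphereInfluenceAssembly

/-! ## `ScoreLinearResponse` ⇒ the mean hydrodynamic limit (any packing guard) -/

/-- **Score-response dominance (mean form).** The crux `ScoreLinearResponse` of route
`OneSphereInfluence` implies the mean hydrodynamic limit in the dilute band
`ResponseRigidity.MeanHydroLimitInBand` (stmt-AtomisticToContinuum-11927) — indeed without using the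
packing guard (`η := 1` is arbitrary): pre-shock homotopy through `t` (`preShockHomotopy_holds`), the
finite-`N` score identity and the mean value inequality in `κ` anchored at the flow-invariant constant
state (`HomogeneousInvariance_holds`, `κ = 0` law of large numbers), i.e. the mean half of
`oneSphereInfluence_assembly` through the landed `tendsto_integral_of_uniform_covariance`. [folklore] -/
theorem meanHydroLimitInBand_of_scoreLinearResponse
    (hS : OneSphereInfluence.ScoreLinearResponse) : ResponseRigidity.MeanHydroLimitInBand := by
  refine ⟨1, one_pos, ?_⟩
  intro a₁ θ₁ u₁ ha₁ hθ₁ hu₁ ha₁0 hθ₁0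
  obtain ⟨Λ, hΛ, σP, hσP, hPσ⟩ := PreShockDoor.preShockHomotopy_holds a₁ θ₁ u₁ ha₁ hθ₁ hu₁ ha₁0 hθ₁0
  obtain ⟨σS, hσS, hSσ⟩ := hS a₁ θ₁ u₁ ha₁ hθ₁ hu₁ ha₁0 hθ₁0 Λ hΛ
  refine ⟨min σP σS, lt_min hσP hσS, ?_⟩
  intro σ hσ hσlt T ρ θ u hsol _hguard Φ hinit t ht
  have hσP' : σ < σP := lt_of_lt_of_le hσlt (min_le_left _ _)
  have hσS' : σ < σS := lt_of_lt_of_le hσlt (min_le_right _ _)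
  -- the pre-shock homotopy through `t`
  obtain ⟨T', htT', a, θ₀, u₀, ρh, θh, uh, ha, hθs, hus, hhull, hconst, ha1, hθ1, hu1, hsols, hρc, huc, hθc,
    hlln, hprobL, hρ1, hu1', hθ1', hconst0⟩ := hPσ σ hσ hσP' T ρ θ u hsol Φ hinit t ht
  subst ha1 hθ1 hu1 hρ1 hu1' hθ1'
  have htI : t ∈ Ico 0 T' := ⟨ht.1, htT'⟩
  have hT' : (0 : ℝ) < T' := ht.1.trans_lt htT'
  have h0T : (0 : ℝ) ∈ Ico 0 T' := ⟨le_rfl, hT'⟩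
  have h0I : (0 : ℝ) ∈ Icc (0 : ℝ) 1 := ⟨le_rfl, zero_le_one⟩
  have h1I : (1 : ℝ) ∈ Icc (0 : ℝ) 1 := ⟨zero_le_one, le_rfl⟩
  have hSt := hSσ σ hσ hσS' a θ₀ u₀ ha hθs hus hhull hconst rfl rfl rfl T' ρh θh uh hsols hρc huc hθc Φ hlln t htI
  -- positivity of the path profiles
  have hinf : 0 < Λ⁻¹ * ⨅ y, a 1 y :=
    mul_pos (inv_pos.2 (zero_lt_one.trans_le hΛ)) (iInf_pos_of_continuous ha₁ ha₁0)
  have ha0 : ∀ κ ∈ Icc (0 : ℝ) 1, ∀ x, 0 < a κ x := fun κ hκ x => hinf.trans_le (hhull κ hκ x).1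
  have hθ0 : ∀ κ ∈ Icc (0 : ℝ) 1, ∀ x, 0 < θ₀ κ x := fun κ hκ x => (hhull κ hκ x).2.2
  have hprobM : ∀ κ ∈ Icc (0 : ℝ) 1, ∀ N, IsProbabilityMeasure (localGibbsMeasure σ (a κ) (u₀ κ) (θ₀ κ) N) :=
    fun κ hκ N => by rw [← localGibbsLaw_eq σ _ _ _ N (Φ N)]; exact hprobL κ hκ N
  -- the constant state at `κ = 0`
  have hcpos : 0 < a 0 0 := ha0 0 h0I 0
  have hθcpos : 0 < θ₀ 0 0 := hθ0 0 h0I 0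
  have hlaw0 : ∀ N, localGibbsLaw σ (a 0) (u₀ 0) (θ₀ 0) N (Φ N) =
      localGibbsLaw σ (fun _ => a 0 0) (fun _ => u₀ 0 0) (fun _ => θ₀ 0 0) N (Φ N) := fun N => by
    congr 1 <;> funext x
    exacts [(hconst x).1, (hconst x).2.2, (hconst x).2.1]
  have hmeas0 : ∀ N, localGibbsMeasure σ (a 0) (u₀ 0) (θ₀ 0) N =
      localGibbsMeasure σ (fun _ => a 0 0) (fun _ => u₀ 0 0) (fun _ => θ₀ 0 0) N := fun N => by
    rw [← localGibbsLaw_eq σ _ _ _ N (Φ N), hlaw0, localGibbsLaw_eq]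
  have hinv : ∀ (N : ℕ) (s : ℝ), (Φ N).lawAt (localGibbsLaw σ (fun _ => a 0 0) (fun _ => u₀ 0 0)
      (fun _ => θ₀ 0 0) N (Φ N)) s = localGibbsLaw σ (fun _ => a 0 0) (fun _ => u₀ 0 0) (fun _ => θ₀ 0 0) N (Φ N) :=
    fun N s => HomogeneousInvariance_holds σ (a 0 0) (θ₀ 0 0) (u₀ 0 0) hσ hcpos hθcpos N (Φ N) s
  have hprobc : ∀ N, IsProbabilityMeasure (localGibbsMeasure σ (fun _ => a 0 0) (fun _ => u₀ 0 0)
      (fun _ => θ₀ 0 0) N) := fun N => by rw [← hmeas0]; exact hprobM 0 h0I N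
  -- continuity of the slices of the Euler family at the constant end
  have hρcont0 : Continuous (ρh 0 0) := ((hsols 0 h0I).smooth_density.isSmooth_slice h0T).continuous
  have hucont0 : Continuous (uh 0 0) := ((hsols 0 h0I).smooth_velocity.isSmooth_slice h0T).continuous
  -- constancy of the `κ = 0` member
  have hρ0t : ∀ x, ρh 0 t x = ρh 0 0 x := fun x => by rw [(hconst0 t htI x).1, (hconst0 0 h0T x).1]
  have hu0t : ∀ x, uh 0 t x = uh 0 0 x := fun x => by rw [(hconst0 t htI x).2.1, (hconst0 0 h0T x).2.1]
  have hθ0t : ∀ x, θh 0 t x = θh 0 0 x := fun x => by rw [(hconst0 t htI x).2.2, (hconst0 0 h0T x).2.2]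
  intro χ hχs
  have hχ : Continuous χ := hχs.continuous
  obtain ⟨Cχ, hCχ0, hCχ⟩ := exists_forall_abs_le_of_continuous hχ
  have hSχ := hSt χ hχ
  dsimp only at hSχ
  obtain ⟨hSd, hSm, hSe⟩ := hSχ
  simp_rw [localGibbsLaw_eq] at hSd hSm hSe ⊢
  -- the common core, for one scalar observable: MEANS only
  have core : ∀ (F₀ : (N : ℕ) → Config (N + 1) (Fin 3) T3 → ℝ) (G : ℝ → ℝ) (k : Fin 5),
      (∀ N, Continuous (F₀ N)) →
      (∀ N z, |F₀ N z| ≤ Cχ * (1 + (((N + 1 : ℕ) : ℝ))⁻¹ * ∑ i, ‖(z i).2‖ ^ 2)) →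
      (∀ N, ∀ z ∈ (Φ N).good, |F₀ N ((Φ N).flow t z)| ≤ Cχ * (1 + (((N + 1 : ℕ) : ℝ))⁻¹ * ∑ i, ‖(z i).2‖ ^ 2)) →
      (∀ κ, G κ = ∫ x, χ x * (consState (ρh κ t x) (uh κ t x) (θh κ t x)) k) →
      ∀ c₀ : ℝ, c₀ = G 0 →
      TendstoUniformlyOn (fun N κ => cov[fun z => ∑ i, derivWithin
          (fun κ' => Real.log (localGibbsProfile (a κ') (u₀ κ') (θ₀ κ') (z i))) (Icc 0 1) κ,
          fun z => F₀ N ((Φ N).flow t z); localGibbsMeasure σ (a κ) (u₀ κ) (θ₀ κ) N])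
        (fun κ => derivWithin G (Icc 0 1) κ) atTop (Icc 0 1) →
      (∀ δ' > (0 : ℝ), Tendsto (fun N => localGibbsLaw σ (a 0) (u₀ 0) (θ₀ 0) N (Φ N)
        {z | δ' < |F₀ N ((Φ N).flow 0 z) - c₀|}) atTop (𝓝 0)) →
      Tendsto (fun N => ∫ z, F₀ N ((Φ N).flow t z) ∂localGibbsMeasure σ (a 1) (u₀ 1) (θ₀ 1) N)
        atTop (𝓝 (G 1)) := by
    intro F₀ G k hF₀c hF₀b hFb hGeq c₀ hc₀ hcov hlln0
    have hFm : ∀ N, Measurable fun z => F₀ N ((Φ N).flow t z) := fun N =>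
      (hF₀c N).measurable.comp ((Φ N).measurable_flow t)
    -- differentiability of the limit field within `[0,1]`
    have hG : ∀ κ ∈ Icc (0 : ℝ) 1, DifferentiableWithinAt ℝ G (Icc 0 1) κ := by
      intro κ hκ
      have h := (hasDerivWithinAt_integral_mul_consState_apply hρc huc hθc htI hχ k hκ).differentiableWithinAt
      rw [show G = fun κ' => ∫ x, χ x * (consState (ρh κ' t x) (uh κ' t x) (θh κ' t x)) k from funext hGeq]
      exact h
    -- the `κ = 0` anchor
    have h0 : Tendsto (fun N => ∫ z, F₀ N ((Φ N).flow t z) ∂localGibbsMeasure σ (a 0) (u₀ 0) (θ₀ 0) N)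
        atTop (𝓝 (G 0)) := by
      simp_rw [hmeas0, ← hc₀]
      refine tendsto_integral_comp_flow_const σ (a 0 0) (θ₀ 0 0) (u₀ 0 0) hθcpos hcpos.le Φ hinv hprobc
        (fun N => (hF₀c N).measurable) hCχ0 hF₀b (fun δ' hδ' => ?_) t
      simpa only [hlaw0] using hlln0 δ' hδ'
    exact tendsto_integral_of_uniform_covariance ha hθs hus ha0 hθ0 σ Φ hprobM hFm hCχ0 hFb hG hcov h0
  refine ⟨?_, fun l => ?_, ?_⟩
  · -- density
    have h := core (fun N z => empiricalDensityField z χ) (fun κ => ∫ x, χ x * ρh κ t x) 0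
      (fun N => continuous_empiricalDensityField hχ) (fun N z => abs_empiricalDensityField_le z hCχ)
      (fun N z hz => abs_empiricalDensityField_flow_le (Φ N) hCχ t hz)
      (fun κ => by simp [consState]) (∫ x, χ x * ρh 0 0 x) (by simp only [hρ0t]) hSd
      (fun δ' hδ' => (hlln 0 h0I χ hχ δ' hδ').1)
    simpa using h
  · -- momentum, coordinate `l`
    have hI0l : (∫ x, (χ x * ρh 0 0 x) • uh 0 0 x) l = ∫ x, χ x * ρh 0 0 x * uh 0 0 x l :=
      integral_smul_apply hχ hρcont0 hucont0 l
    have h := core (fun N z => empiricalMomentumField z χ l) (fun κ => ∫ x, χ x * ρh κ t x * uh κ t x l)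
      (HsState.momentumIdx l)
      (fun N => (continuous_apply l).comp
        ((PiLp.continuous_ofLp 2 _).comp (continuous_empiricalMomentumField hχ)))
      (fun N z => abs_empiricalMomentumField_apply_le z hCχ l)
      (fun N z hz => abs_empiricalMomentumField_flow_apply_le (Φ N) hCχ t l hz)
      (fun κ => by simp [consState, mul_assoc]) (∫ x, χ x * ρh 0 0 x * uh 0 0 x l)
      (by simp only [hρ0t, hu0t]) (hSm l)
      (fun δ' hδ' => by
        have hv := tendsto_measure_lt_abs_apply_of_norm (hlln 0 h0I χ hχ δ' hδ').2.1 l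
        refine hv.congr fun N => ?_
        congr 1
        ext z
        simp only [Set.mem_setOf_eq, PiLp.sub_apply, hI0l])
    simpa using h
  · -- energy
    have h := core (fun N z => empiricalEnergyField z χ)
      (fun κ => ∫ x, χ x * totalEnergyDensity (ρh κ t x) (uh κ t x) (θh κ t x)) 4
      (fun N => continuous_empiricalEnergyField hχ) (fun N z => abs_empiricalEnergyField_le z hCχ)
      (fun N z hz => abs_empiricalEnergyField_flow_le (Φ N) hCχ t hz)
      (fun κ => by simp [consState]) (∫ x, χ x * totalEnergyDensity (ρh 0 0 x) (uh 0 0 x) (θh 0 0 x))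
      (by simp only [hρ0t, hu0t, hθ0t]) hSe (fun δ' hδ' => (hlln 0 h0I χ hχ δ' hδ').2.2)
    simpa using h

/-! ## The piece `[M]` of node «AscoliMeanDoor» is itself ≥ the conjunct -/

/-- **`[M]` ⇒ the mean hydrodynamic limit.** `AscoliMeanDoor.MeanConvergenceOnHull` (mean convergence
along every hull path, for every `κ ∈ [0,1]`) implies `ResponseRigidity.MeanHydroLimitInBand`: take the
pre-shock homotopy through `t` (`preShockHomotopy_holds`) and read `[M]` at `κ = 1`. Its converse up
to the `Λ`-uniformity of `σ₀` is the uniform-integrability direction of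
`hydrodynamicLimit_iff_meanHydroLimitInBand`; so `[M]` is a COSTUME of the conjunct's mean form, as
tagged. [folklore] -/
theorem meanHydroLimitInBand_of_meanConvergenceOnHull
    (hM : AscoliMeanDoor.MeanConvergenceOnHull) : ResponseRigidity.MeanHydroLimitInBand := by
  refine ⟨1, one_pos, ?_⟩
  intro a₁ θ₁ u₁ ha₁ hθ₁ hu₁ ha₁0 hθ₁0
  obtain ⟨Λ, hΛ, σP, hσP, hPσ⟩ := PreShockDoor.preShockHomotopy_holds a₁ θ₁ u₁ ha₁ hθ₁ hu₁ ha₁0 hθ₁0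
  obtain ⟨σM, hσM, hMσ⟩ := hM a₁ θ₁ u₁ ha₁ hθ₁ hu₁ ha₁0 hθ₁0 Λ hΛ
  refine ⟨min σP σM, lt_min hσP hσM, ?_⟩
  intro σ hσ hσlt T ρ θ u hsol _hguard Φ hinit t ht
  have hσP' : σ < σP := lt_of_lt_of_le hσlt (min_le_left _ _)
  have hσM' : σ < σM := lt_of_lt_of_le hσlt (min_le_right _ _)
  obtain ⟨T', htT', a, θ₀, u₀, ρh, θh, uh, ha, hθs, hus, hhull, hconst, ha1, hθ1, hu1, hsols, hρc, huc, hθc,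
    hlln, hprobL, hρ1, hu1', hθ1', hconst0⟩ := hPσ σ hσ hσP' T ρ θ u hsol Φ hinit t ht
  subst ha1 hθ1 hu1 hρ1 hu1' hθ1'
  have htI : t ∈ Ico 0 T' := ⟨ht.1, htT'⟩
  have h1I : (1 : ℝ) ∈ Icc (0 : ℝ) 1 := ⟨zero_le_one, le_rfl⟩
  intro χ hχs
  have hχ : Continuous χ := hχs.continuous
  have hMt := hMσ σ hσ hσM' a θ₀ u₀ ha hθs hus hhull hconst rfl rfl rfl T' ρh θh uh hsols hρc huc hθc Φ hlln
    t htI χ hχ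
  dsimp only at hMt
  obtain ⟨hMd, hMm, hMe⟩ := hMt
  exact ⟨hMd 1 h1I, fun j => hMm j 1 h1I, hMe 1 h1I⟩

#print axioms meanHydroLimitInBand_of_scoreLinearResponse
#print axioms meanHydroLimitInBand_of_meanConvergenceOnHull

end Summit.AtomisticToContinuum.HydrodynamicLimit.Theorems.ScoreResponseDominance

end
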